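import Literature.Topology.FourManifolds.TrisectionsTriNormalForm
import Literature.Topology.FourManifolds.CollarUniquenessBall

/-!
# Helpers for stub `stub_unitSector` of line `lp-by-sphere-system-surgery` (crux `AgkCor6Sufficiency`,
item stmt-SmoothPoincare4-10894, routes CongruenceShadows / GroupTrisection; lead reshape r5, A1)

Pure calculus for the unit normalisation of a sector normal form (`…StubUnitSector.lean`): the
ambient Morse presentation `G = 1 - 2uv·κ` of a sector is blended to `1 - 2uv` near the central
surface by `G̃ = 1 - 2uv·k`, `k = κ + ℓ((u² + v²)/η)(1 - κ)`, where `ℓ` is a **log-slow** step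
(`|s ℓ'(s)| ≤ ε`).  This file proves, and bundles in the registered helper stub
`stub_unitSectorProfileToolkit : UnitSectorProfileToolkit`:

1. `exists_logSlow_profile`: for every `ε > 0` a smooth step `ℓ : ℝ → ℝ` with values in `[0, 1]`,
   `ℓ = 1` on `(-∞, a]` (`0 < a < 1`), `ℓ = 0` on `[1, ∞)` and `|s ℓ'(s)| ≤ ε` everywhere (the
   tree's `logCutoff L`, `L = C₀/ε + 1`, made constant `1` near `0`);
2. `hasDerivAt_unitBlend_line`: along a normal line `s ↦ (a + s, c)` (`c > 0`) the chart function
   `1 - 2(a + s)c [k₀ + P((a + s)² + c²)(1 - k₀)]` has negative derivative at `0` as soon as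
   `|tP'(t)| ≤ ε`, `0 ≤ P ≤ 1`, `0 < m ≤ min(k₀, 1)` and `2ε|1 - k₀| ≤ m/2` (the derivative is
   `-2c(A + B)` with `A ≥ m`, `|B| = 2a²|P'(t)||1 - k₀| ≤ 2|tP'(t)||1 - k₀| ≤ m/2`);
3. `fderiv_ne_zero_of_unitBlend`: hence a chart function of the form
   `1 - 2 w₀ w₁ [K(w') + P(w₀² + w₁²)(1 - K(w'))]` near a point `z ≠` corner of the closed
   quadrant has nonzero derivative at `z` (move in the `u`- or in the `v`-direction).

## References

* A. Abrams, D. Gay, R. Kirby, *Group trisections and smooth 4-manifolds*, Geom. Topol. 22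
  (2018), proof of Thm. 5. [AbramsGayKirby2018]
* J. Milnor, *Morse theory* (1963), §2. [Milnor1963]
-/

noncomputable section

-- the prescribed namespace `Summit.<P>.<Sub>.…` duplicates `SmoothPoincare4` (P = Sub)
set_option linter.dupNamespace false

open Set Function Filter
open scoped Manifold ContDiff Topology

namespace Summit.SmoothPoincare4.SmoothPoincare4.Cruxes.AgkCor6Sufficiency.LpBySphereSystemSurgery

open Literature.Topology.FourManifolds

/-! ## 1. The log-slow step -/

/-- **A log-slow smooth step.**  For every `ε > 0` there are a smooth `ℓ : ℝ → ℝ` with values in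
`[0, 1]` and `0 < a < 1` such that `ℓ = 1` on `(-∞, a]`, `ℓ = 0` on `[1, ∞)` and
`|s · ℓ'(s)| ≤ ε` for all `s` (take `logCutoff L` with `C₀ / L ≤ ε`, continued by `1` to the
left of `e^{-2L} / 2`). [folklore] -/
theorem exists_logSlow_profile {ε : ℝ} (hε : 0 < ε) :
    ∃ (ℓ : ℝ → ℝ) (a : ℝ), 0 < a ∧ a < 1 ∧ ContDiff ℝ ∞ ℓ ∧ (∀ s, 0 ≤ ℓ s ∧ ℓ s ≤ 1) ∧
      (∀ s, s ≤ a → ℓ s = 1) ∧ (∀ s, 1 ≤ s → ℓ s = 0) ∧ ∀ s, |s * deriv ℓ s| ≤ ε := by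
  set L : ℝ := smoothTransitionDerivBound / ε + 1 with hL
  have hC₀ := smoothTransitionDerivBound_pos
  have hLpos : 0 < L := by positivity
  have hCL : smoothTransitionDerivBound / L ≤ ε := by
    rw [div_le_iff₀ hLpos, hL, mul_add, mul_div_cancel₀ _ hε.ne', mul_one]
    linarith
  set a : ℝ := Real.exp (-2 * L) with ha
  have hapos : 0 < a := Real.exp_pos _
  have ha1 : a < 1 := Real.exp_lt_one_iff.2 (by linarith)
  have heL1 : Real.exp (-L) ≤ 1 := Real.exp_le_one_iff.2 (by linarith)
  set ℓ : ℝ → ℝ := fun s => if s ≤ a / 2 then 1 else logCutoff L s with hℓ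
  -- values
  have hone : ∀ s, s ≤ a → ℓ s = 1 := by
    intro s hs
    by_cases h : s ≤ a / 2
    · simp only [hℓ, if_pos h]
    · simp only [hℓ, if_neg h]
      exact logCutoff_eq_one hLpos (by linarith) hs
  have hzero : ∀ s, 1 ≤ s → ℓ s = 0 := by
    intro s hs
    have h : ¬ s ≤ a / 2 := by linarith
    simp only [hℓ, if_neg h]
    exact logCutoff_eq_zero hLpos (heL1.trans hs)
  have h01 : ∀ s, 0 ≤ ℓ s ∧ ℓ s ≤ 1 := by
    intro s
    by_cases h : s ≤ a / 2
    · simp only [hℓ, if_pos h]; norm_num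
    · simp only [hℓ, if_neg h]; exact ⟨logCutoff_nonneg _ _, logCutoff_le_one _ _⟩
  -- local descriptions
  have hleft : ∀ s, s < a → ℓ =ᶠ[𝓝 s] fun _ => (1 : ℝ) := fun s hs => by
    filter_upwards [Iio_mem_nhds hs] with w hw using hone w (le_of_lt hw)
  have hright : ∀ s, a / 2 < s → ℓ =ᶠ[𝓝 s] logCutoff L := fun s hs => by
    filter_upwards [Ioi_mem_nhds hs] with w hw
    simp only [hℓ, if_neg (not_le.2 (mem_Ioi.1 hw))]
  have hsmooth : ContDiff ℝ ∞ ℓ := by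
    refine contDiff_iff_contDiffAt.2 fun s => ?_
    by_cases hs : s < a
    · exact contDiffAt_const.congr_of_eventuallyEq (hleft s hs)
    · have hs' : a / 2 < s := by linarith [not_lt.1 hs]
      exact (contDiffAt_logCutoff (by linarith : s ≠ 0)).congr_of_eventuallyEq (hright s hs')
  refine ⟨ℓ, a, hapos, ha1, hsmooth, h01, hone, hzero, fun s => ?_⟩
  by_cases hs : s < a
  · rw [(hleft s hs).deriv_eq, deriv_const, mul_zero, abs_zero]; exact hε.le
  · have hs' : a / 2 < s := by linarith [not_lt.1 hs]
    rw [(hright s hs').deriv_eq]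
    exact (abs_mul_deriv_logCutoff_le hLpos (by linarith : s ≠ 0)).trans hCL

/-! ## 2. The derivative along a normal line -/

/-- **The derivative of the blended corner function along a normal line.**  For `P`
differentiable with values in `[0, 1]` and `|t · P'(t)| ≤ ε`, and constants `0 < m ≤ 1`,
`m ≤ k₀`, `2ε|1 - k₀| ≤ m / 2`, `c > 0` (any `a`), the function
`φ(s) = 1 - 2(a + s) c [k₀ + P((a + s)² + c²)(1 - k₀)]` has negative derivative at `0`: it is
`-2c(A + B)` with `A = (1 - P)k₀ + P ≥ m` and `|B| = 2a²|P'(t)||1 - k₀| ≤ 2|tP'(t)||1 - k₀| ≤ m/2`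
(`t = a² + c² ≥ a²`). [folklore] -/
theorem hasDerivAt_unitBlend_line {P : ℝ → ℝ} (hPd : Differentiable ℝ P)
    (hP01 : ∀ t, 0 ≤ P t ∧ P t ≤ 1) {ε : ℝ} (hPε : ∀ t, |t * deriv P t| ≤ ε)
    {m k₀ a c : ℝ} (hm : 0 < m) (hm1 : m ≤ 1) (hmk : m ≤ k₀)
    (hk : 2 * ε * |1 - k₀| ≤ m / 2) (hc : 0 < c) :
    ∃ φ' : ℝ, φ' < 0 ∧ HasDerivAt
      (fun s : ℝ => 1 - 2 * (a + s) * c * (k₀ + P ((a + s) ^ 2 + c ^ 2) * (1 - k₀))) φ' 0 := by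
  have hlin : HasDerivAt (fun s : ℝ => a + s) 1 0 := (hasDerivAt_id 0).const_add a
  have hin : HasDerivAt (fun s : ℝ => (a + s) ^ 2 + c ^ 2) (2 * a) 0 :=
    ((hlin.pow 2).add_const (c ^ 2)).congr_deriv (by norm_num)
  have hψ : HasDerivAt (fun s : ℝ => P ((a + s) ^ 2 + c ^ 2))
      (deriv P ((a + 0) ^ 2 + c ^ 2) * (2 * a)) 0 :=
    (hPd _).hasDerivAt.comp 0 hin
  set d : ℝ := deriv P (a ^ 2 + c ^ 2) with hd
  have hd' : deriv P ((a + 0) ^ 2 + c ^ 2) = d := by rw [hd, add_zero]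
  rw [hd'] at hψ
  have hbr : HasDerivAt (fun s : ℝ => k₀ + P ((a + s) ^ 2 + c ^ 2) * (1 - k₀))
      (d * (2 * a) * (1 - k₀)) 0 := (hψ.mul_const (1 - k₀)).const_add k₀
  have hprod := ((hlin.const_mul 2).mul_const c).mul hbr
  have hφ := hprod.const_sub 1
  -- name the pieces of the derivative
  set A : ℝ := k₀ + P (a ^ 2 + c ^ 2) * (1 - k₀) with hA
  set B : ℝ := 2 * a ^ 2 * d * (1 - k₀) with hB
  refine ⟨-(2 * c * (A + B)), ?_, ?_⟩
  · -- ### the sign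
    set w : ℝ := P (a ^ 2 + c ^ 2) with hw
    have hw01 : 0 ≤ w ∧ w ≤ 1 := hP01 _
    have hAeq : A = (1 - w) * k₀ + w := by rw [hA, hw]; ring
    have hAge : m ≤ A := by
      rw [hAeq]
      nlinarith [mul_nonneg (sub_nonneg.2 hw01.2) (sub_nonneg.2 hmk),
        mul_nonneg hw01.1 (sub_nonneg.2 hm1)]
    have ht : 0 < a ^ 2 + c ^ 2 := by positivity
    have h1 : a ^ 2 * |d| ≤ ε := by
      have h := hPε (a ^ 2 + c ^ 2)
      rw [← hd, abs_mul, abs_of_pos ht] at h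
      nlinarith [abs_nonneg d, sq_nonneg c]
    have hBle : |B| ≤ m / 2 := by
      calc |B| = 2 * (a ^ 2 * |d|) * |1 - k₀| := by
            rw [hB, abs_mul, abs_mul, abs_mul, abs_of_pos (two_pos : (0:ℝ) < 2),
              abs_of_nonneg (sq_nonneg a)]; ring
        _ ≤ 2 * ε * |1 - k₀| := by gcongr
        _ ≤ m / 2 := hk
    have hBge : -(m / 2) ≤ B := by have := (abs_le.1 hBle).1; linarith
    have hsum : 0 < A + B := by linarith
    have : 0 < 2 * c * (A + B) := by positivity
    linarith
  · -- ### the derivative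
    have hfun : (fun s : ℝ => 1 - 2 * (a + s) * c * (k₀ + P ((a + s) ^ 2 + c ^ 2) * (1 - k₀))) =
        fun x => 1 - ((fun y => 2 * (a + y) * c) * fun s =>
          k₀ + P ((a + s) ^ 2 + c ^ 2) * (1 - k₀)) x := by
      funext s
      simp only [Pi.mul_apply]
    rw [hfun]
    refine hφ.congr_deriv ?_
    rw [hA, hB]
    simp only [add_zero, mul_one]
    ring

/-! ## 3. No critical points of the blended function off the corner -/

/-- **The blended chart function is regular off the corner.**  Let `Ĝ` be differentiable at a
point `z` of the closed quadrant off the corner (`z₀, z₁ ≥ 0`, not both `0`) and, on an open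
`D ∋ z`, of the form `Ĝ(w) = 1 - 2 w₀ w₁ [K(w') + P(w₀² + w₁²)(1 - K(w'))]` (`w' = stratumProj w`)
with `P` as in `hasDerivAt_unitBlend_line` and `m ≤ K(z')`, `2ε|1 - K(z')| ≤ m/2`.  Then
`dĜ(z) ≠ 0`: along the half-line `z + s e₀` (if `z₁ > 0`) or `z + s e₁` (if `z₁ = 0 < z₀`) the
function has nonzero derivative (`fderiv_ne_zero_of_eventuallyEq_line`). [folklore] -/
theorem fderiv_ne_zero_of_unitBlend {Gh : EuclideanSpace ℝ (Fin 4) → ℝ}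
    {z : EuclideanSpace ℝ (Fin 4)} (hGhd : DifferentiableAt ℝ Gh z)
    {D : Set (EuclideanSpace ℝ (Fin 4))} (hDo : IsOpen D) (hzD : z ∈ D)
    {K : EuclideanSpace ℝ (Fin 4) → ℝ} {P : ℝ → ℝ}
    (hformula : ∀ w ∈ D, Gh w = 1 - 2 * w 0 * w 1 *
      (K (stratumProj w) + P (w 0 ^ 2 + w 1 ^ 2) * (1 - K (stratumProj w))))
    (hPd : Differentiable ℝ P) (hP01 : ∀ t, 0 ≤ P t ∧ P t ≤ 1) {ε m : ℝ}
    (hPε : ∀ t, |t * deriv P t| ≤ ε) (hm : 0 < m) (hm1 : m ≤ 1) (hmK : m ≤ K (stratumProj z))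
    (hk : 2 * ε * |1 - K (stratumProj z)| ≤ m / 2)
    (hz0 : 0 ≤ z 0) (hz1 : 0 ≤ z 1) (hne : z 0 ≠ 0 ∨ z 1 ≠ 0) : fderiv ℝ Gh z ≠ 0 := by
  -- points of the lines stay in `D`
  have hnear : ∀ e : EuclideanSpace ℝ (Fin 4), ∀ᶠ s in 𝓝[≥] (0:ℝ), z + s • e ∈ D := by
    intro e
    have hcont : Continuous fun s : ℝ => z + s • e := by fun_prop
    have hlim : Tendsto (fun s : ℝ => z + s • e) (𝓝 0) (𝓝 z) := by simpa using hcont.tendsto 0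
    exact (hlim.eventually (hDo.mem_nhds hzD)).filter_mono nhdsWithin_le_nhds
  set k₀ : ℝ := K (stratumProj z) with hk₀
  by_cases hv : 0 < z 1
  · -- ### move in the `u`-direction
    set e0 : EuclideanSpace ℝ (Fin 4) := EuclideanSpace.single 0 (1:ℝ) with he0
    have ha : ∀ s : ℝ, (z + s • e0) 0 = z 0 + s := fun s => by simp [he0]
    have hb : ∀ s : ℝ, (z + s • e0) 1 = z 1 := fun s => by simp [he0]
    have hsP : ∀ s : ℝ, stratumProj (z + s • e0) = stratumProj z := fun s => by
      ext i; fin_cases i <;> simp [stratumProj, he0]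
    obtain ⟨φ', hφ'neg, hφ'⟩ := hasDerivAt_unitBlend_line (a := z 0) (c := z 1) (k₀ := k₀)
      hPd hP01 hPε hm hm1 hmK hk hv
    have heq : ∀ᶠ s in 𝓝[≥] (0:ℝ), Gh (z + s • e0) =
        1 - 2 * (z 0 + s) * z 1 * (k₀ + P ((z 0 + s) ^ 2 + z 1 ^ 2) * (1 - k₀)) := by
      filter_upwards [hnear e0] with s hs
      rw [hformula _ hs, hsP, ← hk₀, ha, hb]
    exact fderiv_ne_zero_of_eventuallyEq_line hGhd hφ' hφ'neg.ne heq
  · -- ### `z 1 = 0`, so `z 0 > 0`: move in the `v`-direction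
    have hv0' : z 1 = 0 := le_antisymm (not_lt.1 hv) hz1
    have hu : 0 < z 0 := lt_of_le_of_ne hz0 fun h0 => by
      rcases hne with h | h
      · exact h h0.symm
      · exact h hv0'
    set e1 : EuclideanSpace ℝ (Fin 4) := EuclideanSpace.single 1 (1:ℝ) with he1
    have ha : ∀ s : ℝ, (z + s • e1) 1 = z 1 + s := fun s => by simp [he1]
    have hb : ∀ s : ℝ, (z + s • e1) 0 = z 0 := fun s => by simp [he1]
    have hsP : ∀ s : ℝ, stratumProj (z + s • e1) = stratumProj z := fun s => by
      ext i; fin_cases i <;> simp [stratumProj, he1]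
    obtain ⟨φ', hφ'neg, hφ'⟩ := hasDerivAt_unitBlend_line (a := z 1) (c := z 0) (k₀ := k₀)
      hPd hP01 hPε hm hm1 hmK hk hu
    have heq : ∀ᶠ s in 𝓝[≥] (0:ℝ), Gh (z + s • e1) =
        1 - 2 * (z 1 + s) * z 0 * (k₀ + P ((z 1 + s) ^ 2 + z 0 ^ 2) * (1 - k₀)) := by
      filter_upwards [hnear e1] with s hs
      rw [hformula _ hs, hsP, ← hk₀, ha, hb]
      ring_nf
    exact fderiv_ne_zero_of_eventuallyEq_line hGhd hφ' hφ'neg.ne heq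

/-! ## The toolkit (a registered helper stub) -/

/-- **The unit-sector profile toolkit** (registered helper stub of the line, proved in this
file): the log-slow step, the line derivative of the blended corner function, and the regularity
of the blended chart function off the corner. -/
def UnitSectorProfileToolkit : Prop :=
  (∀ ε : ℝ, 0 < ε →
    ∃ (ℓ : ℝ → ℝ) (a : ℝ), 0 < a ∧ a < 1 ∧ ContDiff ℝ ∞ ℓ ∧ (∀ s, 0 ≤ ℓ s ∧ ℓ s ≤ 1) ∧
      (∀ s, s ≤ a → ℓ s = 1) ∧ (∀ s, 1 ≤ s → ℓ s = 0) ∧ ∀ s, |s * deriv ℓ s| ≤ ε) ∧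
  (∀ (P : ℝ → ℝ), Differentiable ℝ P → (∀ t, 0 ≤ P t ∧ P t ≤ 1) → ∀ (ε : ℝ),
    (∀ t, |t * deriv P t| ≤ ε) → ∀ (m k₀ a c : ℝ), 0 < m → m ≤ 1 → m ≤ k₀ →
    2 * ε * |1 - k₀| ≤ m / 2 → 0 < c →
    ∃ φ' : ℝ, φ' < 0 ∧ HasDerivAt
      (fun s : ℝ => 1 - 2 * (a + s) * c * (k₀ + P ((a + s) ^ 2 + c ^ 2) * (1 - k₀))) φ' 0) ∧
  (∀ (Gh : EuclideanSpace ℝ (Fin 4) → ℝ) (z : EuclideanSpace ℝ (Fin 4)), DifferentiableAt ℝ Gh z →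
    ∀ (D : Set (EuclideanSpace ℝ (Fin 4))), IsOpen D → z ∈ D →
    ∀ (K : EuclideanSpace ℝ (Fin 4) → ℝ) (P : ℝ → ℝ),
    (∀ w ∈ D, Gh w = 1 - 2 * w 0 * w 1 *
      (K (stratumProj w) + P (w 0 ^ 2 + w 1 ^ 2) * (1 - K (stratumProj w)))) →
    Differentiable ℝ P → (∀ t, 0 ≤ P t ∧ P t ≤ 1) → ∀ (ε m : ℝ),
    (∀ t, |t * deriv P t| ≤ ε) → 0 < m → m ≤ 1 → m ≤ K (stratumProj z) →
    2 * ε * |1 - K (stratumProj z)| ≤ m / 2 →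
    0 ≤ z 0 → 0 ≤ z 1 → (z 0 ≠ 0 ∨ z 1 ≠ 0) → fderiv ℝ Gh z ≠ 0)

/-- **Registered helper stub `stub_unitSectorProfileToolkit`** of line
`lp-by-sphere-system-surgery` (toolkit for the unit normalisation `stub_unitSector`). [folklore] -/
theorem stub_unitSectorProfileToolkit : UnitSectorProfileToolkit :=
  ⟨fun _ hε => exists_logSlow_profile hε,
    fun _ hPd hP01 _ hPε _ _ _ _ hm hm1 hmk hk hc =>
      hasDerivAt_unitBlend_line hPd hP01 hPε hm hm1 hmk hk hc,
    fun _ _ hGhd _ hDo hzD _ _ hformula hPd hP01 _ _ hPε hm hm1 hmK hk hz0 hz1 hne =>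
      fderiv_ne_zero_of_unitBlend hGhd hDo hzD hformula hPd hP01 hPε hm hm1 hmK hk hz0 hz1 hne⟩

end Summit.SmoothPoincare4.SmoothPoincare4.Cruxes.AgkCor6Sufficiency.LpBySphereSystemSurgery

end
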